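import Literature.Analysis.FluidPDE.AxisymWeights
import Literature.Analysis.FluidPDE.TaoEnstrophyIdentity
import HarnessLib

/-!
# Ladyzhenskaya's weighted enstrophy estimate, I: the inequality at a fixed time

Analysis/FluidPDE proof file (all results proved, no definitions) on the decomposition path of
the named fact `Literature.Analysis.FluidPDE.axisymmetricNoSwirl_enstrophy_apriori`
(Lemarié-Rieusset 2016, Thm. 10.4). Ladyzhenskaya's key observation in the proof of global
regularity for axisymmetric flows without swirl is the uniform control of `∫ |ω(t)|² r⁻² dx`
((10.25)–(10.27), pp. 286–288): writing `ω = f · J` (`f = ω_θ/r`, `Jx = r e_θ`) and testing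
the enstrophy identity against the regularised weight `α_ε(r) r⁻²`, the transport and
stretching terms cancel ((10.25)), the viscous term is a dissipation plus weight-derivative
terms, and the latter vanish as `ε → 0` (the book inserts an extra factor `r^η`, `η → 0`, to
control the axis shell; here `f` is known to be smooth and bounded across the axis — the
Hadamard quotient of `AxisymNoSwirlVorticity` — so the shell terms are `O(ε)` directly).

This file proves the resulting inequality **at a fixed time** for a classical solution on the
closed slab `[0, T] × ℝ³`, against the whole-space weight `η_{ε,R} = α_ε χ_R / ρ` of
`AxisymWeights` (`ρ = x₀² + x₁²`; an outer cutoff `χ_R` is needed on `ℝ³`):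

* `ladyzhenskaya_core` — the real-variable bookkeeping (Young's inequality for the `∇χ_R` cross
  term, the sign of the axis term, the `R⁻¹` terms);
* `ladyzhenskaya_integrand_le` — the pointwise bound for the four densities of the weighted
  enstrophy identity (`TaoEnstrophyIdentity.integral_enstrophyProduction_mul_weight`), via the
  algebra of `AxisymVorticityAlgebra.ladyzhenskaya_integrand_eq`:
  `… ≤ (3νFG + F²V/2) ‖Dα_ε‖ χ_R + f² (144νD² + 4νD + 2√2DV)/R`;
* `ladyzhenskaya_slice_le` — integrating:
  `∫ ⟨ω, ∂ₜω⟩ η_{ε,R} ≤ 64 D (3νFG + F²V/2) ε R + (144νD² + 4νD + 2√2DV) R⁻¹ ∫ f²`,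
  where `F, G, V` bound `|f|, ‖Df‖, |u|` at that time and `D` bounds `|smoothTransition'|`.

The time integration and the limits `ε → 0`, `R → ∞` are in `LadyzhenskayaWeightedEstimate`.

## References

* P. G. Lemarié-Rieusset, *The Navier–Stokes Problem in the 21st Century*, CRC Press (2016),
  §10.3, proof of Thm. 10.4, (10.25)–(10.27), pp. 286–288. [LemarieRieusset2016]
* O. A. Ladyzhenskaya, Zap. Naučn. Sem. LOMI 7 (1968) 155–177; S. Leonardi, J. Málek,
  J. Nečas, M. Pokorný, Z. Anal. Anwendungen 18 (1999) 639–649 (the book's [295], [326]).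
-/

noncomputable section

open Set Function Filter MeasureTheory Metric
open scoped RealInnerProductSpace ENNReal NNReal Topology

namespace Literature.Analysis.FluidPDE

section Core

/-- **The real-variable core of the pointwise bound.** With `P = Σ pⱼ²` (`|∇f|²`), `a = α_ε`,
`c = χ_R = s²`, bounds `|pⱼ| ≤ G`, `|f| ≤ F`, `|aⱼ| ≤ da` (`∂ⱼα_ε`), `|cⱼ| ≤ dc ≤ (4√2D/R) s`
(`∂ⱼχ_R`), `|Au| ≤ da V`, `|Cu| ≤ dc V` (`U·∇α_ε`, `U·∇χ_R`), `C₁ ≥ 0` (`x_h·∇α_ε`),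
`|C₂| ≤ 4Dρ/R²` (`x_h·∇χ_R`):
`−νPac − νf Σpⱼ(acⱼ + caⱼ) − νf²(x_h·∇(ac))/ρ + ½f²(U·∇(ac))
  ≤ (3νFG + F²V/2) da c + f² (144νD² + 4νD + 2√2DV)/R`
(Young's inequality absorbs the `pⱼ cⱼ` cross term into the dissipation `νPac`; the axis term
`−νf²cC₁/ρ ≤ 0` is dropped). [folklore] -/
theorem ladyzhenskaya_core {ν F G V D R ρ a c s f da dc Au Cu C₁ C₂ x0 x1 : ℝ} {p a' c' : Fin 3 → ℝ}
    (hν : 0 ≤ ν) (hR : 1 ≤ R) (hρ : 0 < ρ) (ha0 : 0 ≤ a) (ha1 : a ≤ 1) (hs0 : 0 ≤ s)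
    (hs1 : s ≤ 1) (hc : c = s ^ 2) (hf : |f| ≤ F) (hp : ∀ j, |p j| ≤ G)
    (ha' : ∀ j, |a' j| ≤ da) (hc' : ∀ j, |c' j| ≤ dc) (hdc : dc ≤ 4 * Real.sqrt 2 * D / R * s)
    (hAu : |Au| ≤ da * V) (hCu : |Cu| ≤ dc * V) (hC₁ : 0 ≤ C₁) (hC₁' : C₁ = x0 * a' 0 + x1 * a' 1)
    (hC₂ : |C₂| ≤ 4 * D * ρ / R ^ 2) (hC₂' : C₂ = x0 * c' 0 + x1 * c' 1)
    (hD : 0 ≤ D) (hG : 0 ≤ G) (hV : 0 ≤ V) :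
    -(ν * ((∑ j, p j ^ 2) * (a * c)))
      - ν * (f * ∑ j, p j * (a * c' j + c * a' j))
      - ν * (f ^ 2 * (x0 * (a * c' 0 + c * a' 0) + x1 * (a * c' 1 + c * a' 1)) / ρ)
      + 1 / 2 * (f ^ 2 * (a * Cu + c * Au)) ≤
    (3 * ν * F * G + F ^ 2 * V / 2) * (da * c) +
      f ^ 2 * ((144 * ν * D ^ 2 + 4 * ν * D + 2 * Real.sqrt 2 * D * V) / R) := by
  have hF0 : 0 ≤ F := (abs_nonneg f).trans hf
  have hc0 : 0 ≤ c := by rw [hc]; positivity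
  have hc1 : c ≤ 1 := by rw [hc]; nlinarith
  have hR0 : 0 < R := by linarith
  have hRinv : 1 / R ^ 2 ≤ 1 / R :=
    one_div_le_one_div_of_le hR0 (by nlinarith)
  have hdc0 : 0 ≤ dc := (abs_nonneg _).trans (hc' 0)
  have hsq2 : 0 ≤ Real.sqrt 2 := Real.sqrt_nonneg 2
  have hf2 : f ^ 2 ≤ F ^ 2 := by
    calc f ^ 2 = |f| ^ 2 := (sq_abs f).symm
      _ ≤ F ^ 2 := pow_le_pow_left₀ (abs_nonneg f) hf 2
  -- (1) the `aⱼ` cross term: `−ν f c pⱼ aⱼ ≤ νFG da c`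
  have h1 : ∀ j, -(ν * (f * (p j * (c * a' j)))) ≤ ν * F * G * (da * c) := by
    intro j
    have hb : |f * (p j * (c * a' j))| ≤ F * (G * (c * da)) := by
      rw [abs_mul, abs_mul, abs_mul, abs_of_nonneg hc0]
      have e1 : c * |a' j| ≤ c * da := mul_le_mul_of_nonneg_left (ha' j) hc0
      have e2 : |p j| * (c * |a' j|) ≤ G * (c * da) := mul_le_mul (hp j) e1 (by positivity) hG
      exact mul_le_mul hf e2 (by positivity) hF0
    have hC : -(f * (p j * (c * a' j))) ≤ |f * (p j * (c * a' j))| := neg_le_abs _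
    calc -(ν * (f * (p j * (c * a' j)))) = ν * (-(f * (p j * (c * a' j)))) := by ring
      _ ≤ ν * (F * (G * (c * da))) := mul_le_mul_of_nonneg_left (hC.trans hb) hν
      _ = ν * F * G * (da * c) := by ring
  -- (2) the `cⱼ` cross term, absorbed: `−ν f a pⱼ cⱼ ≤ (ν/6) pⱼ² a c + 48 ν D² f² / R²`
  have h2 : ∀ j, -(ν * (f * (p j * (a * c' j)))) ≤
      ν / 6 * (p j ^ 2 * (a * c)) + 48 * ν * D ^ 2 * f ^ 2 / R ^ 2 := by
    intro j
    -- `|f pⱼ a cⱼ| ≤ a (|pⱼ| s) (|f| 4√2 D/R)`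
    have hb : |f * (p j * (a * c' j))| ≤
        a * ((|p j| * s) * (|f| * (4 * Real.sqrt 2 * D / R))) := by
      rw [abs_mul, abs_mul, abs_mul, abs_of_nonneg ha0]
      have h' : |c' j| ≤ 4 * Real.sqrt 2 * D / R * s := (hc' j).trans hdc
      calc |f| * (|p j| * (a * |c' j|)) = a * (|p j| * |c' j| * |f|) := by ring
        _ ≤ a * (|p j| * (4 * Real.sqrt 2 * D / R * s) * |f|) := by gcongr
        _ = a * ((|p j| * s) * (|f| * (4 * Real.sqrt 2 * D / R))) := by ring
    -- Young: `x y ≤ x²/6 + 3y²/2`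
    have hy : (|p j| * s) * (|f| * (4 * Real.sqrt 2 * D / R)) ≤
        (|p j| * s) ^ 2 / 6 + 3 / 2 * (|f| * (4 * Real.sqrt 2 * D / R)) ^ 2 := by
      nlinarith [sq_nonneg (|p j| * s - 3 * (|f| * (4 * Real.sqrt 2 * D / R)))]
    have hx2 : (|p j| * s) ^ 2 = p j ^ 2 * c := by rw [mul_pow, sq_abs, hc]
    have hy2 : (|f| * (4 * Real.sqrt 2 * D / R)) ^ 2 = 32 * D ^ 2 * f ^ 2 / R ^ 2 := by
      rw [mul_pow, sq_abs, div_pow, mul_pow, mul_pow, Real.sq_sqrt (by norm_num : (0:ℝ) ≤ 2)]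
      ring
    rw [hx2, hy2] at hy
    have hA := hb.trans (mul_le_mul_of_nonneg_left hy ha0)
    have e : a * (p j ^ 2 * c / 6 + 3 / 2 * (32 * D ^ 2 * f ^ 2 / R ^ 2)) =
        p j ^ 2 * (a * c) / 6 + a * (48 * D ^ 2 * f ^ 2 / R ^ 2) := by ring
    have e2 : a * (48 * D ^ 2 * f ^ 2 / R ^ 2) ≤ 48 * D ^ 2 * f ^ 2 / R ^ 2 :=
      mul_le_of_le_one_left (by positivity) ha1
    have hB : a * (p j ^ 2 * c / 6 + 3 / 2 * (32 * D ^ 2 * f ^ 2 / R ^ 2)) ≤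
        p j ^ 2 * (a * c) / 6 + 48 * D ^ 2 * f ^ 2 / R ^ 2 := by rw [e]; linarith
    have hC : -(f * (p j * (a * c' j))) ≤ |f * (p j * (a * c' j))| := neg_le_abs _
    calc -(ν * (f * (p j * (a * c' j)))) = ν * (-(f * (p j * (a * c' j)))) := by ring
      _ ≤ ν * (p j ^ 2 * (a * c) / 6 + 48 * D ^ 2 * f ^ 2 / R ^ 2) :=
          mul_le_mul_of_nonneg_left (hC.trans (hA.trans hB)) hν
      _ = ν / 6 * (p j ^ 2 * (a * c)) + 48 * ν * D ^ 2 * f ^ 2 / R ^ 2 := by ring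
  -- (3) the axis term has the good sign
  have h3 : -(ν * (f ^ 2 * (c * C₁) / ρ)) ≤ 0 := by
    have : 0 ≤ ν * (f ^ 2 * (c * C₁) / ρ) := by positivity
    linarith
  -- (4) the outer radial term: `ν f² a |C₂|/ρ ≤ 4νD f²/R²`
  have h4 : -(ν * (f ^ 2 * (a * C₂) / ρ)) ≤ 4 * ν * D * f ^ 2 / R ^ 2 := by
    have hb : |f ^ 2 * (a * C₂) / ρ| ≤ f ^ 2 * (4 * D / R ^ 2) := by
      rw [abs_div, abs_mul, abs_mul, abs_of_nonneg (sq_nonneg f), abs_of_nonneg ha0,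
        abs_of_pos hρ, div_le_iff₀ hρ]
      calc f ^ 2 * (a * |C₂|) ≤ f ^ 2 * (1 * (4 * D * ρ / R ^ 2)) := by gcongr
        _ = f ^ 2 * (4 * D / R ^ 2) * ρ := by field_simp
    have hC : -(f ^ 2 * (a * C₂) / ρ) ≤ |f ^ 2 * (a * C₂) / ρ| := neg_le_abs _
    calc -(ν * (f ^ 2 * (a * C₂) / ρ)) = ν * (-(f ^ 2 * (a * C₂) / ρ)) := by ring
      _ ≤ ν * (f ^ 2 * (4 * D / R ^ 2)) := mul_le_mul_of_nonneg_left (hC.trans hb) hν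
      _ = 4 * ν * D * f ^ 2 / R ^ 2 := by ring
  -- (5) transport through the axis cutoff: `½ f² c Au ≤ ½ F² V da c`
  have h5 : 1 / 2 * (f ^ 2 * (c * Au)) ≤ F ^ 2 * V / 2 * (da * c) := by
    have hb : |f ^ 2 * (c * Au)| ≤ F ^ 2 * (c * (da * V)) := by
      rw [abs_mul, abs_mul, abs_of_nonneg (sq_nonneg f), abs_of_nonneg hc0]
      have e1 : c * |Au| ≤ c * (da * V) := mul_le_mul_of_nonneg_left hAu hc0
      exact mul_le_mul hf2 e1 (by positivity) (by positivity)
    have hC := le_abs_self (f ^ 2 * (c * Au))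
    calc 1 / 2 * (f ^ 2 * (c * Au)) ≤ 1 / 2 * (F ^ 2 * (c * (da * V))) := by linarith
      _ = F ^ 2 * V / 2 * (da * c) := by ring
  -- (6) transport through the ball cutoff: `½ f² a Cu ≤ 2√2 D V f²/R`
  have h6 : 1 / 2 * (f ^ 2 * (a * Cu)) ≤ 2 * Real.sqrt 2 * D * V * f ^ 2 / R := by
    have hCu' : |Cu| ≤ 4 * Real.sqrt 2 * D / R * V := by
      calc |Cu| ≤ dc * V := hCu
        _ ≤ 4 * Real.sqrt 2 * D / R * s * V := by gcongr
        _ ≤ 4 * Real.sqrt 2 * D / R * 1 * V := by gcongr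
        _ = _ := by ring
    have hb : |f ^ 2 * (a * Cu)| ≤ f ^ 2 * (1 * (4 * Real.sqrt 2 * D / R * V)) := by
      rw [abs_mul, abs_mul, abs_of_nonneg (sq_nonneg f), abs_of_nonneg ha0]
      exact mul_le_mul_of_nonneg_left (mul_le_mul ha1 hCu' (abs_nonneg _) zero_le_one)
        (sq_nonneg f)
    have hC := le_abs_self (f ^ 2 * (a * Cu))
    calc 1 / 2 * (f ^ 2 * (a * Cu)) ≤ 1 / 2 * (f ^ 2 * (1 * (4 * Real.sqrt 2 * D / R * V))) := by
          linarith
      _ = 2 * Real.sqrt 2 * D * V * f ^ 2 / R := by ring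
  -- the dissipation absorbs the Young remainders
  have hP : -(ν * ((p 0 ^ 2 + p 1 ^ 2 + p 2 ^ 2) * (a * c))) +
      (ν / 6 * (p 0 ^ 2 * (a * c)) + ν / 6 * (p 1 ^ 2 * (a * c)) + ν / 6 * (p 2 ^ 2 * (a * c))) ≤
      0 := by
    have h0 : 0 ≤ ν * ((p 0 ^ 2 + p 1 ^ 2 + p 2 ^ 2) * (a * c)) := by positivity
    have e : -(ν * ((p 0 ^ 2 + p 1 ^ 2 + p 2 ^ 2) * (a * c))) +
        (ν / 6 * (p 0 ^ 2 * (a * c)) + ν / 6 * (p 1 ^ 2 * (a * c)) +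
          ν / 6 * (p 2 ^ 2 * (a * c))) =
        -(5 / 6) * (ν * ((p 0 ^ 2 + p 1 ^ 2 + p 2 ^ 2) * (a * c))) := by ring
    rw [e]; linarith
  -- the `R⁻²` terms are `≤` the `R⁻¹` terms
  have htail : 3 * (48 * ν * D ^ 2 * f ^ 2 / R ^ 2) + 4 * ν * D * f ^ 2 / R ^ 2 +
      2 * Real.sqrt 2 * D * V * f ^ 2 / R ≤
      f ^ 2 * ((144 * ν * D ^ 2 + 4 * ν * D + 2 * Real.sqrt 2 * D * V) / R) := by
    have h0 : 0 ≤ 144 * ν * D ^ 2 * f ^ 2 + 4 * ν * D * f ^ 2 := by positivity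
    have key := mul_le_mul_of_nonneg_left hRinv h0
    have e : f ^ 2 * ((144 * ν * D ^ 2 + 4 * ν * D + 2 * Real.sqrt 2 * D * V) / R) =
        (144 * ν * D ^ 2 * f ^ 2 + 4 * ν * D * f ^ 2) * (1 / R) +
          2 * Real.sqrt 2 * D * V * f ^ 2 / R := by ring
    have e' : 3 * (48 * ν * D ^ 2 * f ^ 2 / R ^ 2) + 4 * ν * D * f ^ 2 / R ^ 2 =
        (144 * ν * D ^ 2 * f ^ 2 + 4 * ν * D * f ^ 2) * (1 / R ^ 2) := by ring
    rw [e, e']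
    linarith
  -- expand the left-hand side into the eight pieces and add up
  have hX : -(ν * ((∑ j, p j ^ 2) * (a * c)))
      - ν * (f * ∑ j, p j * (a * c' j + c * a' j))
      - ν * (f ^ 2 * (x0 * (a * c' 0 + c * a' 0) + x1 * (a * c' 1 + c * a' 1)) / ρ)
      + 1 / 2 * (f ^ 2 * (a * Cu + c * Au)) =
      -(ν * ((p 0 ^ 2 + p 1 ^ 2 + p 2 ^ 2) * (a * c)))
      + (-(ν * (f * (p 0 * (a * c' 0)))) + -(ν * (f * (p 1 * (a * c' 1)))) +
          -(ν * (f * (p 2 * (a * c' 2)))))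
      + (-(ν * (f * (p 0 * (c * a' 0)))) + -(ν * (f * (p 1 * (c * a' 1)))) +
          -(ν * (f * (p 2 * (c * a' 2)))))
      + -(ν * (f ^ 2 * (a * C₂) / ρ)) + -(ν * (f ^ 2 * (c * C₁) / ρ))
      + 1 / 2 * (f ^ 2 * (a * Cu)) + 1 / 2 * (f ^ 2 * (c * Au)) := by
    rw [hC₁', hC₂', Fin.sum_univ_three, Fin.sum_univ_three]
    field_simp
    ring
  rw [hX]
  linarith [h1 0, h1 1, h1 2, h2 0, h2 1, h2 2, h3, h4, h5, h6, hP, htail]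

end Core

/-! ### The pointwise bound for the actual weights -/

section Pointwise

variable {f : EuclideanSpace ℝ (Fin 3) → ℝ}
  {ω U : EuclideanSpace ℝ (Fin 3) → EuclideanSpace ℝ (Fin 3)} {x : EuclideanSpace ℝ (Fin 3)}

/-- **The pointwise bound for Ladyzhenskaya's weighted enstrophy integrand.** Let `ω = f · J`
with `f` differentiable at `x`, `DU(x)[Jx] = J U(x)`, and let
`η = α_ε χ_R / ρ` be the weight of `AxisymWeights` (`α_ε(x) = sT(ρ/ε² − 1)`,
`χ_R(x) = sT(2 − |x|²/R²)²`). If `|f(x)| ≤ F`, `‖Df(x)‖ ≤ G`, `|U(x)| ≤ V`, `ν ≥ 0`, `R ≥ 1`,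
then the sum of the four densities of the weighted enstrophy identity at `x` is at most
`(3νFG + F²V/2) ‖Dα_ε(x)‖ χ_R(x) + f(x)² (144νD² + 4νD + 2√2DV)/R`
(`D` a bound for `|sT'|`): the dissipation `−ν|∇f|²α_εχ_R` absorbs the cross term with
`∇χ_R`, the axis term carrying `x_h·∇α_ε ≥ 0` is dropped, and what is left lives either on
the shell `ε² < ρ < 2ε²` (factor `‖Dα_ε‖`) or carries a factor `R⁻¹` (Lemarié-Rieusset 2016,
pp. 287–288: the terms with `α'(r/ε)/ε` and the passage `ε → 0`).
[cite: LemarieRieusset2016, §10.3 pp. 287–288] -/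
theorem ladyzhenskaya_integrand_le (hω : ω = fun y => f y • rotGen y)
    (hf : DifferentiableAt ℝ f x) (hax : fderiv ℝ U x (rotGen x) = rotGen (U x))
    {ν : ℝ} (hν : 0 ≤ ν) {D : ℝ} (hD : ∀ t, |deriv Real.smoothTransition t| ≤ D)
    {ε R : ℝ} (hε : 0 < ε) (hR : 1 ≤ R) {F G V : ℝ} (hF : |f x| ≤ F)
    (hG : ‖fderiv ℝ f x‖ ≤ G) (hV : ‖U x‖ ≤ V) :
    -(ν * (frobeniusNormSq (fderiv ℝ ω x) *
        (Real.smoothTransition ((x 0 ^ 2 + x 1 ^ 2) / ε ^ 2 - 1) *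
          Real.smoothTransition (2 - ‖x‖ ^ 2 / R ^ 2) ^ 2 / (x 0 ^ 2 + x 1 ^ 2))))
      - ν * (∑ j, ⟪ω x, fderiv ℝ ω x (EuclideanSpace.single j (1 : ℝ))⟫ *
          fderiv ℝ (fun y : EuclideanSpace ℝ (Fin 3) =>
            Real.smoothTransition ((y 0 ^ 2 + y 1 ^ 2) / ε ^ 2 - 1) *
              Real.smoothTransition (2 - ‖y‖ ^ 2 / R ^ 2) ^ 2 / (y 0 ^ 2 + y 1 ^ 2)) x
            (EuclideanSpace.single j (1 : ℝ)))
      + 1 / 2 * (‖ω x‖ ^ 2 *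
          fderiv ℝ (fun y : EuclideanSpace ℝ (Fin 3) =>
            Real.smoothTransition ((y 0 ^ 2 + y 1 ^ 2) / ε ^ 2 - 1) *
              Real.smoothTransition (2 - ‖y‖ ^ 2 / R ^ 2) ^ 2 / (y 0 ^ 2 + y 1 ^ 2)) x (U x))
      + ⟪ω x, fderiv ℝ U x (ω x)⟫ *
          (Real.smoothTransition ((x 0 ^ 2 + x 1 ^ 2) / ε ^ 2 - 1) *
            Real.smoothTransition (2 - ‖x‖ ^ 2 / R ^ 2) ^ 2 / (x 0 ^ 2 + x 1 ^ 2)) ≤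
    (3 * ν * F * G + F ^ 2 * V / 2) *
        (‖fderiv ℝ (fun y : EuclideanSpace ℝ (Fin 3) =>
            Real.smoothTransition ((y 0 ^ 2 + y 1 ^ 2) / ε ^ 2 - 1)) x‖ *
          Real.smoothTransition (2 - ‖x‖ ^ 2 / R ^ 2) ^ 2) +
      f x ^ 2 * ((144 * ν * D ^ 2 + 4 * ν * D + 2 * Real.sqrt 2 * D * V) / R) := by
  -- names
  set α : EuclideanSpace ℝ (Fin 3) → ℝ := fun y =>
    Real.smoothTransition ((y 0 ^ 2 + y 1 ^ 2) / ε ^ 2 - 1) with hαdef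
  set χ : EuclideanSpace ℝ (Fin 3) → ℝ := fun y =>
    Real.smoothTransition (2 - ‖y‖ ^ 2 / R ^ 2) ^ 2 with hχdef
  have hD0 : 0 ≤ D := (abs_nonneg _).trans (hD 0)
  have hF0 : 0 ≤ F := (abs_nonneg _).trans hF
  have hG0 : 0 ≤ G := (norm_nonneg _).trans hG
  have hV0 : 0 ≤ V := (norm_nonneg _).trans hV
  have hR0 : 0 < R := by linarith
  have hχ0 : 0 ≤ χ x := sq_nonneg _
  have hrhs : 0 ≤ (3 * ν * F * G + F ^ 2 * V / 2) * (‖fderiv ℝ α x‖ * χ x) +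
      f x ^ 2 * ((144 * ν * D ^ 2 + 4 * ν * D + 2 * Real.sqrt 2 * D * V) / R) := by
    positivity
  by_cases hρ : x 0 ^ 2 + x 1 ^ 2 = 0
  · -- on the axis the weight and its derivative vanish
    have hlt : x 0 ^ 2 + x 1 ^ 2 < ε ^ 2 := by rw [hρ]; positivity
    have hD0' := fderiv_axisWeight_eq_zero hε R hlt
    rw [hD0', hρ]
    simp only [div_zero, mul_zero, neg_zero, zero_apply, Finset.sum_const_zero, sub_zero,
      add_zero]
    simpa [hρ] using hrhs
  -- off the axis: Ladyzhenskaya's algebra, then the real-variable core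
  have hαd : DifferentiableAt ℝ α x := differentiable_axisCutoff ε x
  have hχd : DifferentiableAt ℝ χ x := differentiable_sqBallCutoff R x
  have hw : DifferentiableAt ℝ (fun y => α y * χ y) x := hαd.mul hχd
  have key := ladyzhenskaya_integrand_eq hω hf (w := fun y => α y * χ y) hw hρ hax ν
  refine key.trans_le ?_
  have hDw : fderiv ℝ (fun y => α y * χ y) x = α x • fderiv ℝ χ x + χ x • fderiv ℝ α x :=
    fderiv_fun_mul hαd hχd
  simp only [hDw, add_apply, FunLike.coe_smul, Pi.smul_apply, smul_eq_mul]
  -- the ingredients of the core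
  have hρpos : 0 < x 0 ^ 2 + x 1 ^ 2 := lt_of_le_of_ne (by positivity) (Ne.symm hρ)
  have hsingle : ∀ j : Fin 3, ‖(EuclideanSpace.single j (1 : ℝ) : EuclideanSpace ℝ (Fin 3))‖ = 1 :=
    fun j => by rw [PiLp.norm_single, norm_one]
  have hp : ∀ j : Fin 3, |fderiv ℝ f x (EuclideanSpace.single j (1 : ℝ))| ≤ G := fun j => by
    rw [← Real.norm_eq_abs]
    calc _ ≤ ‖fderiv ℝ f x‖ * ‖(EuclideanSpace.single j (1 : ℝ) : EuclideanSpace ℝ (Fin 3))‖ :=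
          ContinuousLinearMap.le_opNorm _ _
      _ ≤ G := by rw [hsingle, mul_one]; exact hG
  have ha' : ∀ j : Fin 3, |fderiv ℝ α x (EuclideanSpace.single j (1 : ℝ))| ≤ ‖fderiv ℝ α x‖ :=
    fun j => by
    rw [← Real.norm_eq_abs]
    calc _ ≤ ‖fderiv ℝ α x‖ * ‖(EuclideanSpace.single j (1 : ℝ) : EuclideanSpace ℝ (Fin 3))‖ :=
          ContinuousLinearMap.le_opNorm _ _
      _ = ‖fderiv ℝ α x‖ := by rw [hsingle, mul_one]
  have hc' : ∀ j : Fin 3, |fderiv ℝ χ x (EuclideanSpace.single j (1 : ℝ))| ≤ ‖fderiv ℝ χ x‖ :=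
    fun j => by
    rw [← Real.norm_eq_abs]
    calc _ ≤ ‖fderiv ℝ χ x‖ * ‖(EuclideanSpace.single j (1 : ℝ) : EuclideanSpace ℝ (Fin 3))‖ :=
          ContinuousLinearMap.le_opNorm _ _
      _ = ‖fderiv ℝ χ x‖ := by rw [hsingle, mul_one]
  have hdc : ‖fderiv ℝ χ x‖ ≤
      4 * Real.sqrt 2 * D / R * Real.smoothTransition (2 - ‖x‖ ^ 2 / R ^ 2) :=
    norm_fderiv_sqBallCutoff_le hD hR0 x
  have hAu : |fderiv ℝ α x (U x)| ≤ ‖fderiv ℝ α x‖ * V := by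
    rw [← Real.norm_eq_abs]
    exact (ContinuousLinearMap.le_opNorm _ _).trans (mul_le_mul_of_nonneg_left hV (norm_nonneg _))
  have hCu : |fderiv ℝ χ x (U x)| ≤ ‖fderiv ℝ χ x‖ * V := by
    rw [← Real.norm_eq_abs]
    exact (ContinuousLinearMap.le_opNorm _ _).trans (mul_le_mul_of_nonneg_left hV (norm_nonneg _))
  have hC₁ := horizontal_fderiv_axisCutoff_nonneg ε x
  have hC₂ := abs_horizontal_fderiv_sqBallCutoff_le hD R x
  have hcore := ladyzhenskaya_core (ν := ν) (F := F) (G := G) (V := V) (D := D) (R := R)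
    (ρ := x 0 ^ 2 + x 1 ^ 2) (a := α x) (c := χ x)
    (s := Real.smoothTransition (2 - ‖x‖ ^ 2 / R ^ 2)) (f := f x)
    (da := ‖fderiv ℝ α x‖) (dc := ‖fderiv ℝ χ x‖)
    (Au := fderiv ℝ α x (U x)) (Cu := fderiv ℝ χ x (U x))
    (C₁ := x 0 * fderiv ℝ α x (EuclideanSpace.single 0 (1 : ℝ)) +
      x 1 * fderiv ℝ α x (EuclideanSpace.single 1 (1 : ℝ)))
    (C₂ := x 0 * fderiv ℝ χ x (EuclideanSpace.single 0 (1 : ℝ)) +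
      x 1 * fderiv ℝ χ x (EuclideanSpace.single 1 (1 : ℝ)))
    (x0 := x 0) (x1 := x 1)
    (p := fun j => fderiv ℝ f x (EuclideanSpace.single j (1 : ℝ)))
    (a' := fun j => fderiv ℝ α x (EuclideanSpace.single j (1 : ℝ)))
    (c' := fun j => fderiv ℝ χ x (EuclideanSpace.single j (1 : ℝ)))
    hν hR hρpos (axisCutoff_nonneg ε x) (axisCutoff_le_one ε x)
    (Real.smoothTransition.nonneg _) (Real.smoothTransition.le_one _) rfl hF hp ha' hc' hdc hAu
    hCu hC₁ rfl hC₂ rfl hD0 hG0 hV0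
  exact hcore

end Pointwise

/-! ### The weighted enstrophy inequality at a fixed time -/

section Slice

variable {T ν : ℝ} {u : ℝ → EuclideanSpace ℝ (Fin 3) → EuclideanSpace ℝ (Fin 3)}
  {p : ℝ → EuclideanSpace ℝ (Fin 3) → ℝ}

/-- `‖Dα_ε(x)‖ χ_R(x) ≤ (2√2 D/ε) 𝟙_S(x)` with `S = {ρ ≤ 2ε², |x|² ≤ 2R²}` the thin cylinder
carrying the axis-shell error terms. [folklore] -/
theorem norm_fderiv_axisCutoff_mul_sqBallCutoff_le {D : ℝ}
    (hD : ∀ t, |deriv Real.smoothTransition t| ≤ D)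
    {ε R : ℝ} (hε : 0 < ε) (hR : 0 < R) (x : EuclideanSpace ℝ (Fin 3)) :
    ‖fderiv ℝ (fun y : EuclideanSpace ℝ (Fin 3) =>
        Real.smoothTransition ((y 0 ^ 2 + y 1 ^ 2) / ε ^ 2 - 1)) x‖ *
        Real.smoothTransition (2 - ‖x‖ ^ 2 / R ^ 2) ^ 2 ≤
      2 * Real.sqrt 2 * D / ε *
        {y : EuclideanSpace ℝ (Fin 3) |
            y 0 ^ 2 + y 1 ^ 2 ≤ 2 * ε ^ 2 ∧ ‖y‖ ^ 2 ≤ 2 * R ^ 2}.indicator 1 x := by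
  have hD0 : 0 ≤ D := (abs_nonneg _).trans (hD 0)
  have h1 := norm_fderiv_axisCutoff_le hD hε x
  have hχ1 := sqBallCutoff_le_one R x
  have hχ0 := sqBallCutoff_nonneg R x
  by_cases hx :
      x ∈ {y : EuclideanSpace ℝ (Fin 3) | y 0 ^ 2 + y 1 ^ 2 ≤ 2 * ε ^ 2 ∧ ‖y‖ ^ 2 ≤ 2 * R ^ 2}
  · rw [indicator_of_mem hx, Pi.one_apply, mul_one]
    rw [if_pos hx.1] at h1
    calc _ ≤ 2 * Real.sqrt 2 * D / ε * 1 := mul_le_mul h1 hχ1 hχ0 (by positivity)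
      _ = _ := mul_one _
  · rw [indicator_of_notMem hx, mul_zero]
    simp only [mem_setOf_eq, not_and_or, not_le] at hx
    rcases hx with hx | hx
    · rw [if_neg (not_le.2 hx)] at h1
      have : ‖fderiv ℝ (fun y : EuclideanSpace ℝ (Fin 3) =>
          Real.smoothTransition ((y 0 ^ 2 + y 1 ^ 2) / ε ^ 2 - 1)) x‖ = 0 :=
        le_antisymm h1 (norm_nonneg _)
      rw [this, zero_mul]
    · rw [sqBallCutoff_eq_zero hR hx.le, mul_zero]

/-- **Ladyzhenskaya's weighted enstrophy inequality at a fixed time** (Lemarié-Rieusset 2016,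
pp. 287–288, the differential inequality for `∫ |ω|² α_ε r^{−2} dx`, here with `f = 0`, `η = 0`
and an outer cutoff `χ_R`). For a classical Navier–Stokes solution on `[0, T] × ℝ³` whose slice
`u(t)` is axisymmetric without swirl, with `f = ω_θ/r` (the Hadamard quotient of
`AxisymNoSwirlVorticity`) bounded by `F`, `‖Df‖ ≤ G`, `|u(t)| ≤ V` and `f ∈ L²`, the enstrophy
production against the weight `η_{ε,R} = α_ε χ_R/ρ` — i.e. `d/dt ½∫|ω|²η_{ε,R} = d/dt ½∫ f² α_ε χ_R`
— satisfies
`∫ ⟨ω, ∂ₜω⟩ η_{ε,R} ≤ 64 D (3νFG + F²V/2) ε R + (144νD² + 4νD + 2√2DV) R⁻¹ ∫ f²`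
for `0 < ε`, `1 ≤ R` (`D` a bound for `|sT'|`): an axis-shell error `O(ε)` (for fixed `R`) and an
outer error `O(R⁻¹)`, and no positive bulk term — Ladyzhenskaya's uniform control of
`∫ |ω|² r⁻² dx`. [cite: LemarieRieusset2016, §10.3 (10.25)–(10.27), pp. 286–288] -/
theorem ladyzhenskaya_slice_le (hT : 0 < T) (hν : 0 ≤ ν)
    (hsol : IsClassicalNSSolutionOn (Icc 0 T) ν 0 u p) {t : ℝ} (ht : t ∈ Icc 0 T)
    (hax : IsAxisymmetric (u t)) (hsw : HasNoSwirl (u t))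
    {D : ℝ} (hD : ∀ s, |deriv Real.smoothTransition s| ≤ D) {ε R : ℝ} (hε : 0 < ε) (hR : 1 ≤ R)
    {F G V : ℝ} (hF : ∀ x, |hadamardQuotFst (fun y => curl (u t) y 1) x| ≤ F)
    (hG : ∀ x, ‖fderiv ℝ (hadamardQuotFst (fun y => curl (u t) y 1)) x‖ ≤ G)
    (hV : ∀ x, ‖u t x‖ ≤ V)
    (hint : Integrable (fun x => hadamardQuotFst (fun y => curl (u t) y 1) x ^ 2)) :
    ∫ x, enstrophyProduction T u t x *
        (Real.smoothTransition ((x 0 ^ 2 + x 1 ^ 2) / ε ^ 2 - 1) *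
          Real.smoothTransition (2 - ‖x‖ ^ 2 / R ^ 2) ^ 2 / (x 0 ^ 2 + x 1 ^ 2)) ≤
      64 * D * (3 * ν * F * G + F ^ 2 * V / 2) * ε * R +
        (144 * ν * D ^ 2 + 4 * ν * D + 2 * Real.sqrt 2 * D * V) / R *
          ∫ x, hadamardQuotFst (fun y => curl (u t) y 1) x ^ 2 := by
  -- names
  set f : EuclideanSpace ℝ (Fin 3) → ℝ := hadamardQuotFst (fun y => curl (u t) y 1) with hfdef
  set α : EuclideanSpace ℝ (Fin 3) → ℝ := fun y =>
    Real.smoothTransition ((y 0 ^ 2 + y 1 ^ 2) / ε ^ 2 - 1) with hαdef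
  set χ : EuclideanSpace ℝ (Fin 3) → ℝ := fun y =>
    Real.smoothTransition (2 - ‖y‖ ^ 2 / R ^ 2) ^ 2 with hχdef
  set η : EuclideanSpace ℝ (Fin 3) → ℝ := fun y => α y * χ y / (y 0 ^ 2 + y 1 ^ 2) with hηdef
  have hR0 : 0 < R := by linarith
  have hD0 : 0 ≤ D := (abs_nonneg _).trans (hD 0)
  have hF0 : 0 ≤ F := (abs_nonneg _).trans (hF 0)
  have hG0 : 0 ≤ G := (norm_nonneg _).trans (hG 0)
  have hV0 : 0 ≤ V := (norm_nonneg _).trans (hV 0)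
  -- regularity of the slice
  have hu3 : ContDiff ℝ 3 (u t) := (hsol.contDiff_velocity ht).of_le (by norm_cast)
  have hu2 : ContDiff ℝ 2 (u t) := hu3.of_le (by norm_cast)
  have hu1 : ContDiff ℝ 1 (u t) := hu3.of_le (by norm_cast)
  have hf1 : ContDiff ℝ 1 f := contDiff_hadamardQuotFst_curl (n := 1) (by exact_mod_cast hu3)
  have hω : curl (u t) = fun y => f y • rotGen y :=
    funext fun y => curl_eq_hadamardQuotFst_smul_rotGen hax hsw hu2 y
  have hax' : ∀ x, fderiv ℝ (u t) x (rotGen x) = rotGen (u t x) := fun x =>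
    hax.fderiv_rotGen ((hu1.differentiable one_ne_zero) x)
  have hω1 : ContDiff ℝ 1 (curl (u t)) := contDiff_curl (n := 1) (by exact_mod_cast hu2)
  have hωc : Continuous (curl (u t)) := hω1.continuous
  have hDωc : Continuous (fderiv ℝ (curl (u t))) := hω1.continuous_fderiv one_ne_zero
  have huc : Continuous (u t) := hu1.continuous
  have hDuc : Continuous (fderiv ℝ (u t)) := hu1.continuous_fderiv one_ne_zero
  -- the weight
  have hηs : ContDiff ℝ 1 η := contDiff_axisWeight hε R
  have hηc : HasCompactSupport η := hasCompactSupport_axisWeight ε hR0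
  obtain ⟨K, hK⟩ : ∃ K, LipschitzWith K η := exists_lipschitzWith_axisWeight hε hR0
  have hηd : ∀ x, DifferentiableAt ℝ η x := fun x => (hηs.differentiable one_ne_zero) x
  have hηcont : Continuous η := hηs.continuous
  have hDηc : HasCompactSupport (fderiv ℝ η) := hηc.fderiv ℝ
  have hDηcont : Continuous (fderiv ℝ η) := hηs.continuous_fderiv one_ne_zero
  -- the identity (10.11) with `f = 0`
  have hid := integral_enstrophyProduction_mul_weight hT hsol ht hK hηc
  have hf0 : (∫ x, ⟪curl (u t) x, curl ((0 : ℝ → EuclideanSpace ℝ (Fin 3) →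
      EuclideanSpace ℝ (Fin 3)) t) x⟫ * η x) = 0 := by
    simp [curl_zero]
  rw [hf0, add_zero] at hid
  have hld : ∀ x v, lineDeriv ℝ η x v = fderiv ℝ η x v := fun x v =>
    (hηd x).lineDeriv_eq_fderiv
  simp_rw [hld] at hid
  -- integrability of the four densities
  have hIa : Integrable fun x => frobeniusNormSq (fderiv ℝ (curl (u t)) x) * η x :=
    integrable_mul_of_continuous_of_hasCompactSupport
      (continuous_frobeniusNormSq_fderiv hω1 one_ne_zero) hηcont hηc
  have hIb : ∀ j : Fin 3, Integrable fun x =>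
      ⟪curl (u t) x, fderiv ℝ (curl (u t)) x (EuclideanSpace.single j (1 : ℝ))⟫ *
        fderiv ℝ η x (EuclideanSpace.single j (1 : ℝ)) := fun j =>
    integrable_mul_of_continuous_of_hasCompactSupport
      (hωc.inner (hDωc.clm_apply continuous_const)) (hDηcont.clm_apply continuous_const)
      (hDηc.mono fun x hx => by
        simp only [mem_support, ne_eq] at hx ⊢
        intro h; exact hx (by rw [h]; rfl))
  have hIc : Integrable fun x => ‖curl (u t) x‖ ^ 2 * fderiv ℝ η x (u t x) :=
    integrable_mul_of_continuous_of_hasCompactSupport (hωc.norm.pow 2) (hDηcont.clm_apply huc)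
      (hDηc.mono fun x hx => by
        simp only [mem_support, ne_eq] at hx ⊢
        intro h; exact hx (by rw [h]; rfl))
  have hId : Integrable fun x => ⟪curl (u t) x, convect (curl (u t)) (u t) x⟫ * η x :=
    integrable_mul_of_continuous_of_hasCompactSupport
      (hωc.inner (hDuc.clm_apply hωc)) hηcont hηc
  rw [← integral_finsetSum _ (fun j _ => hIb j)] at hid
  have hIb' : Integrable fun x => ∑ j : Fin 3,
      ⟪curl (u t) x, fderiv ℝ (curl (u t)) x (EuclideanSpace.single j (1 : ℝ))⟫ *
        fderiv ℝ η x (EuclideanSpace.single j (1 : ℝ)) := integrable_finsetSum _ fun j _ => hIb j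
  -- combine into one integral
  have i1 : Integrable fun x => -(ν * (frobeniusNormSq (fderiv ℝ (curl (u t)) x) * η x)) :=
    (hIa.const_mul ν).neg
  have i12 : Integrable fun x => -(ν * (frobeniusNormSq (fderiv ℝ (curl (u t)) x) * η x))
      - ν * (∑ j : Fin 3,
          ⟪curl (u t) x, fderiv ℝ (curl (u t)) x (EuclideanSpace.single j (1 : ℝ))⟫ *
            fderiv ℝ η x (EuclideanSpace.single j (1 : ℝ))) := i1.sub (hIb'.const_mul ν)
  have i123 : Integrable fun x => -(ν * (frobeniusNormSq (fderiv ℝ (curl (u t)) x) * η x))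
      - ν * (∑ j : Fin 3,
          ⟪curl (u t) x, fderiv ℝ (curl (u t)) x (EuclideanSpace.single j (1 : ℝ))⟫ *
            fderiv ℝ η x (EuclideanSpace.single j (1 : ℝ)))
      + 1 / 2 * (‖curl (u t) x‖ ^ 2 * fderiv ℝ η x (u t x)) := i12.add (hIc.const_mul _)
  have hcomb :
      -(ν * ∫ x, frobeniusNormSq (fderiv ℝ (curl (u t)) x) * η x)
        - ν * (∫ x, ∑ j : Fin 3,
            ⟪curl (u t) x, fderiv ℝ (curl (u t)) x (EuclideanSpace.single j (1 : ℝ))⟫ *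
              fderiv ℝ η x (EuclideanSpace.single j (1 : ℝ)))
        + 1 / 2 * (∫ x, ‖curl (u t) x‖ ^ 2 * fderiv ℝ η x (u t x))
        + (∫ x, ⟪curl (u t) x, convect (curl (u t)) (u t) x⟫ * η x) =
      ∫ x, (-(ν * (frobeniusNormSq (fderiv ℝ (curl (u t)) x) * η x))
        - ν * (∑ j : Fin 3,
            ⟪curl (u t) x, fderiv ℝ (curl (u t)) x (EuclideanSpace.single j (1 : ℝ))⟫ *
              fderiv ℝ η x (EuclideanSpace.single j (1 : ℝ)))
        + 1 / 2 * (‖curl (u t) x‖ ^ 2 * fderiv ℝ η x (u t x))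
        + ⟪curl (u t) x, convect (curl (u t)) (u t) x⟫ * η x) := by
    rw [integral_add i123 hId, integral_add i12 (hIc.const_mul _),
      integral_sub i1 (hIb'.const_mul ν), integral_neg, integral_const_mul, integral_const_mul,
      integral_const_mul]
  rw [hid, hcomb]
  -- the majorant
  set S : Set (EuclideanSpace ℝ (Fin 3)) :=
    {y | y 0 ^ 2 + y 1 ^ 2 ≤ 2 * ε ^ 2 ∧ ‖y‖ ^ 2 ≤ 2 * R ^ 2} with hSdef
  have hSm : MeasurableSet S := by
    have h1 : IsClosed {y : EuclideanSpace ℝ (Fin 3) | y 0 ^ 2 + y 1 ^ 2 ≤ 2 * ε ^ 2} :=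
      isClosed_le (contDiff_horizSq (n := 0)).continuous continuous_const
    have h2 : IsClosed {y : EuclideanSpace ℝ (Fin 3) | ‖y‖ ^ 2 ≤ 2 * R ^ 2} :=
      isClosed_le (continuous_norm.pow 2) continuous_const
    exact (h1.inter h2).measurableSet
  have hvolS : volume S ≤ ENNReal.ofReal (16 * Real.sqrt 2 * ε ^ 2 * R) := by
    have h := volume_thinCylinder_le (a := Real.sqrt 2 * ε) (b := Real.sqrt 2 * R)
      (by positivity) (by positivity)
    have e1 : (Real.sqrt 2 * ε) ^ 2 = 2 * ε ^ 2 := by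
      rw [mul_pow, Real.sq_sqrt (by norm_num : (0:ℝ) ≤ 2)]
    have e2 : (Real.sqrt 2 * R) ^ 2 = 2 * R ^ 2 := by
      rw [mul_pow, Real.sq_sqrt (by norm_num : (0:ℝ) ≤ 2)]
    rw [e1, e2] at h
    refine h.trans (le_of_eq ?_)
    congr 1
    ring
  have hvolS' : (volume S).toReal ≤ 16 * Real.sqrt 2 * ε ^ 2 * R :=
    ENNReal.toReal_le_of_le_ofReal (by positivity) hvolS
  have hvolS_top : volume S < ⊤ := lt_of_le_of_lt hvolS ENNReal.ofReal_lt_top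
  set C₁ : ℝ := 3 * ν * F * G + F ^ 2 * V / 2 with hC₁
  set C₂ : ℝ := (144 * ν * D ^ 2 + 4 * ν * D + 2 * Real.sqrt 2 * D * V) / R with hC₂
  have hC₁0 : 0 ≤ C₁ := by positivity
  have hC₂0 : 0 ≤ C₂ := by positivity
  have hInd : Integrable (fun x => S.indicator (1 : EuclideanSpace ℝ (Fin 3) → ℝ) x) :=
    (integrable_indicator_iff hSm).2 (integrableOn_const hvolS_top.ne)
  have hbound : Integrable fun x =>
      C₁ * (2 * Real.sqrt 2 * D / ε) * S.indicator 1 x + C₂ * f x ^ 2 :=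
    (hInd.const_mul _).add (hint.const_mul _)
  -- pointwise comparison
  have hpt : ∀ x,
      (-(ν * (frobeniusNormSq (fderiv ℝ (curl (u t)) x) * η x))
        - ν * (∑ j : Fin 3,
            ⟪curl (u t) x, fderiv ℝ (curl (u t)) x (EuclideanSpace.single j (1 : ℝ))⟫ *
              fderiv ℝ η x (EuclideanSpace.single j (1 : ℝ)))
        + 1 / 2 * (‖curl (u t) x‖ ^ 2 * fderiv ℝ η x (u t x))
        + ⟪curl (u t) x, convect (curl (u t)) (u t) x⟫ * η x) ≤
      C₁ * (2 * Real.sqrt 2 * D / ε) * S.indicator 1 x + C₂ * f x ^ 2 := by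
    intro x
    have h1 := ladyzhenskaya_integrand_le (ω := curl (u t)) (U := u t) hω
      ((hf1.differentiable one_ne_zero) x) (hax' x) hν hD hε hR (hF x) (hG x) (hV x)
    have h2 := norm_fderiv_axisCutoff_mul_sqBallCutoff_le hD hε hR0 x
    have h3 : C₁ * (‖fderiv ℝ α x‖ * χ x) ≤ C₁ * (2 * Real.sqrt 2 * D / ε * S.indicator 1 x) :=
      mul_le_mul_of_nonneg_left h2 hC₁0
    simp only [convect_apply]
    calc _ ≤ C₁ * (‖fderiv ℝ α x‖ * χ x) + f x ^ 2 * C₂ := h1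
      _ ≤ _ := by nlinarith [h3]
  calc _ ≤ ∫ x, C₁ * (2 * Real.sqrt 2 * D / ε) * S.indicator 1 x + C₂ * f x ^ 2 :=
        integral_mono (i123.add hId) hbound hpt
    _ = C₁ * (2 * Real.sqrt 2 * D / ε) * (volume S).toReal + C₂ * ∫ x, f x ^ 2 := by
        rw [integral_add (hInd.const_mul _) (hint.const_mul _), integral_const_mul,
          integral_const_mul, integral_indicator_one hSm]
        rfl
    _ ≤ C₁ * (2 * Real.sqrt 2 * D / ε) * (16 * Real.sqrt 2 * ε ^ 2 * R) + C₂ * ∫ x, f x ^ 2 := by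
        gcongr
    _ = 64 * D * C₁ * ε * R + C₂ * ∫ x, f x ^ 2 := by
        have e : Real.sqrt 2 * Real.sqrt 2 = 2 := Real.mul_self_sqrt (by norm_num)
        have key : C₁ * (2 * Real.sqrt 2 * D / ε) * (16 * Real.sqrt 2 * ε ^ 2 * R) =
            64 * D * C₁ * ε * R := by
          calc _ = 32 * (Real.sqrt 2 * Real.sqrt 2) * D * C₁ * R * (ε * ε / ε) := by ring
            _ = _ := by rw [e, mul_self_div_self]; ring
        rw [key]

end Slice

end Literature.Analysis.FluidPDE

end
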